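import Summits.HodgeConjecture.HodgeConjecture.Theorems.HLiu418S1MultOneFormsOfLetters
import Summits.HodgeConjecture.HodgeConjecture.Theorems.HLiu418S1BettiSliceExclusionSigned
import Summits.HodgeConjecture.HodgeConjecture.Theorems.F0AlbCmS1BettiHolds
import Summits.HodgeConjecture.HodgeConjecture.Theorems.HLiu418S1BettiSliceLinesNoE1   -- N2: (L10)/(L01) WITHOUT E1₂
import HarnessLib

/-!
# Crux `HLiu418`, line `F0_AlbCm` ∕ sub-sub-line `F0_AlbCmS1Betti` — ROAD (A) twin, SIGNED VARIANT WITHOUT E1₂: `stub_S1_betti_holds_signed' : S1BettiShape`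
# MODULO THE FIVE LETTERS {E1′₂h, E3₂♮hol, E3₂♮antihol, D₂h, E₂h} — the multiplicity-one letter E1₂ `curveMultiplicityLeOne` is NOT a hypothesis

Floor-0 programme P5 (Alb-CM), seat F0P5-p03 (g2) (K-lane «N3» of the P5 desk's word #6; the signed variant is F0P5-p04 (g2)'s ★
`Theorems/F0AlbCmS1BettiHoldsSigned.lean`, of which this is the twin with ONE hypothesis fewer); crux item stmt-HodgeConjecture-24832 (`HCCMUnconditional.HLiu418`).
THEOREMS ONLY, def-free, `sorry`-free; named-fact inputs are HYPOTHESES BY THEIR LITERATURE NAMES.  HC_CM is proved only modulo the 7 printed citations until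
rung 0 closes.

`s1MultOneForms_of_signed_letters'` = ★ `F0AlbCmS1BettiHoldsSigned.s1MultOneForms_of_signed_letters` (composition ★ `exists_line_of_split` of (D) ★
`CurveHodgeTypesDisjoint.hodgeTypes₂_disjoint_stable`, (L10)∕(L01), (X) ★ `S1BettiSliceExclusionSigned.stub_X_of_signed_letters`, the `(0,1)`-type letters derived
from their `(1,0)` twins by conjugation ★ `curveCohFinComponentUnique_antihol_of_hol` ∕ `antiholCotFormSpectralProjection₂_of_hol` ∕ `cohIsotypicLine₂_antihol_of_hol`)
with (L10)∕(L01) taken from ★ `S1BettiSliceLinesNoE1.stub_L10_of_letters' ∕ stub_L01_of_letters'` — the line folds that need NO multiplicity one (the only use of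
E1₂, «`P ≠ P₀ ⇒ P ⊥ P₀`» inside the generic core, is replaced by unitarity + discrete decomposability in ★ `Theorems/HLiu418DetectedEqUnitary.lean`,
[Dixmier1977, 5.4.1]).  Same conclusion TOKEN FOR TOKEN (= the body of the sub-sub-line's `S1MultOneFormsShape`).  Hypotheses = FIVE names: E1′hol
`curveCohFinComponentUnique_hol` ([Liu2021, Prop. D.4 (1)]: at most one `(1,0)`-type discrete `P` of `U(J⋆)` has finite component `σ` — THE multiplicity
statement actually consumed), E3hol ∕ E3antihol `curveThetaHodgeTypeSigned_hol ∕ _antihol`, TPhol `holCotFormSpectralProjection₂` (★ `F0P5TP2Holds`), E₂hol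
`cohIsotypicLine₂_hol` (★ `HLiu418E2LevelFinite`).  `stub_S1_betti_holds_signed'` = ★ `F0AlbCmS1BettiHolds.s1BettiShape_of` at ★ `stub_S1_realisation` and this
head; conclusion `F0AlbCmS1BettiHolds.S1BettiShape` (= parent `F0AlbCm.S1BettiShape` token for token), so the parent MAY read (the desk's call)
`theorem stub_S1_facts : Rogawski1990.curveCohFinComponentUnique_hol := by sorry` with
`stub_S1_betti := F0AlbCmS1BettiHoldsSignedNoE1.stub_S1_betti_holds_signed' stub_S1_facts stub_S1b_facts.1 stub_S1b_facts.2 F0P5TP2Holds.… E2LevelFinite.…`,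
i.e. the declared letter E1₂ (multiplicity `≤ 1` on ALL of `L²_disc(U(H))`, [Rogawski1990 §11]) replaced by the weaker E1′hol₂ — while ★ `E1pOfE1` keeps the
road E1₂ ⇒ E1′hol₂ available.

## References
* [Liu2021] Y. Liu, Camb. J. Math. 9 (2021): Prop. D.4 (1) and proof (p. 130–131); Rem. D.5 (p. 131); Lem. D.2 (3).
* [Rogawski1990] Ann. of Math. Stud. 123: §11.1 Prop. 11.1.1; Thm. 11.5.1; §12.3; Thm. 13.3.5 and 13.3.7.
* [Dixmier1977] §5.4 (5.4.1), §13.1.  [BorelJacquet1979] PSPM 33.1, §4.6.  [BorelWallach2000] VII 2.10, 3.2 and 3.6.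
-/

set_option autoImplicit false
-- the mandated namespace repeats `HodgeConjecture.HodgeConjecture`, as in every `Theorems/*.lean` of this sub-problem
set_option linter.dupNamespace false

noncomputable section

namespace Summit.HodgeConjecture.HodgeConjecture.Cruxes.HLiu418.F0AlbCmS1BettiHoldsSignedNoE1

open scoped TensorProduct Matrix NumberField Kronecker ComplexOrder InnerProductSpace ENNReal
open MeasureTheory
open NumberField NumberField.InfinitePlace IsDedekindDomain
open Summit.HodgeConjecture.CorCM.Model Summit.HodgeConjecture.CorCM.Model.HComp Summit.HodgeConjecture.CorCM.HComp
open Literature.AlgebraicGeometry.Motives (CMType AbelianVariety)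
open Literature.AlgebraicGeometry.ShimuraVarieties Literature.AlgebraicGeometry.ShimuraVarieties.UnitaryCanonicalModel
open Literature.NumberTheory.Automorphic Literature.NumberTheory.Automorphic.UnitaryGroup Literature.NumberTheory.Automorphic.UnitaryCurveForms
open Literature.NumberTheory.Automorphic.UnitaryGroup.CotangentForms (toQuotFun toQuotFun_mk)
open Literature.NumberTheory.Automorphic.IdeleClassGroup Literature.NumberTheory.Automorphic.Liu2021 Literature.NumberTheory.Automorphic.Liu2021.AppendixC
open Literature.NumberTheory.GaloisRepresentations Literature.RepresentationTheory.Liu2021 Literature.RepresentationTheory.HarrisKudlaSweet1996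
open Literature.AlgebraicGeometry.Liu2021 (IsAdmissibleElement)
open Literature.NumberTheory.Weil1964 Literature.NumberTheory.GelbartRogawski1991 Literature.NumberTheory.GelbartRogawski1991.UnitaryDualPair Literature.NumberTheory.GelbartRogawski1991.UnitaryDualPair.WeilCoinv
open Literature.NumberTheory.GelbartRogawski1991.UnitaryDualPair.LocalSplitting
open Literature.NumberTheory.Automorphic.Liu2021.Def411WeilCarriersDoubling
open Literature.NumberTheory.Automorphic.Liu2021.Def411WeilCarriers (TW JW JW_eq isSymm_TW isUnit_det_TW Rep Eps epsOf Chi rhoVAtLine rhoAtLine omegaAtLine)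
open Summit.HodgeConjecture.CorCM (CMField)
open Summit.HodgeConjecture.CorCM.Lines.A3Liu418
open Summit.HodgeConjecture.HodgeConjecture.Cruxes.H413.F0P3HilbertProjection
open Summit.HodgeConjecture.HodgeConjecture.Cruxes.H413.SpectrumJunction
open Summit.HodgeConjecture.HodgeConjecture.Cruxes.HLiu418.ScalarSpectralJunction
open Summit.HodgeConjecture.HodgeConjecture.Cruxes.HLiu418.IntertwiningLineOfLetters
open Summit.HodgeConjecture.HodgeConjecture.Cruxes.HLiu418
open Summit.HodgeConjecture.HodgeConjecture.Cruxes.H413.F0P3HJ3aAssembly (left_eq_of_add_eq_add_of_disjoint right_eq_of_add_eq_add_of_disjoint)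
open Summit.HodgeConjecture.HodgeConjecture.Cruxes.HLiu418.S1MultOneFormsOfLetters

set_option synthInstance.maxHeartbeats 400000 in
set_option maxHeartbeats 4000000 in  -- as the ★ twin (the `ω⋆_lab` term)
/-- **HEAD — `S1MultOneFormsShape` MODULO FIVE LETTERS {E1′₂h, E3₂♮hol, E3₂♮antihol, D₂h, E₂h} (NO E1₂)**: the `ω⋆_lab`-equivariant maps into the coherent
curve `1`-forms `cohForms₂ 𝔣` lie on one line.  = ★ `F0AlbCmS1BettiHoldsSigned.s1MultOneForms_of_signed_letters` with (L10)∕(L01) := ★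
`S1BettiSliceLinesNoE1.stub_L10_of_letters' ∕ stub_L01_of_letters'` (no multiplicity one).  Conclusion = the body of the sub-sub-line's `S1MultOneFormsShape`, TOKEN FOR TOKEN.
HC_CM is proved only modulo the 7 printed citations until rung 0 closes.
[cite: Liu2021, Prop. D.4 (1) and proof (p. 130–131); Rem. D.5 (p. 131)] [cite: Rogawski1990, §11.1 Prop. 11.1.1; Thm. 11.5.1; §12.3]
[cite: BorelJacquet1979, §4.6] [cite: BorelWallach2000, VII 2.10, 3.2 and 3.6] -/
theorem s1MultOneForms_of_signed_letters' (hE1'h : Literature.NumberTheory.Rogawski1990.curveCohFinComponentUnique_hol)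
    (hE3hol : Literature.NumberTheory.Rogawski1990.curveThetaHodgeTypeSigned_hol)
    (hE3antihol : Literature.NumberTheory.Rogawski1990.curveThetaHodgeTypeSigned_antihol)
    (hDh : Literature.NumberTheory.Automorphic.UnitaryCurveForms.holCotFormSpectralProjection₂)
    (hEh : Literature.NumberTheory.Automorphic.UnitaryCurveForms.cohIsotypicLine₂_hol) :
      ∀ (F : CMField) [IsGalois ℚ F] (ι₁ : F →+* ℂ)
        (μ : Literature.NumberTheory.Automorphic.IdeleClassGroup (F : Type) →ₜ* Circle)
        (hμ : IdeleClassGroup.IsConjugateSymplectic (F : Type) μ)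
        (_hw : IdeleClassGroup.HasWeight (F : Type) μ 1)
        (Jstar : Matrix (Fin 2) (Fin 2) (F : Type)) (t : (F : Type)) (ht : t ≠ 0) (_hτt : 0 < (ι₁ t).re) (_hτt' : (ι₁ t).im = 0)
        (gstar : GL (Fin 2) (F : Type))
        (dJ : Fin 2 → (F : Type)) (hdJ : ∀ i, IsCMField.complexConj (F : Type) (dJ i) = dJ i) (hdJ0 : ∀ i, dJ i ≠ 0)
        (hg : formCongr ((IsCMField.complexConj (F : Type) : (F : Type) ≃ₐ[↥(maximalRealSubfield (F : Type))] (F : Type)) :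
            (F : Type) →+* (F : Type)) gstar (t • Jstar) = Matrix.diagonal dJ)
        (_hsig : (∃ Tstar : GL (Fin 2) ℂ,
            formCongr (starRingEnd ℂ) Tstar ((Matrix.diagonal dJ).map ι₁) = Matrix.diagonal ![(1 : ℂ), -1]) ∧
          ∀ τ' : (F : Type) →+* ℂ, InfinitePlace.mk τ' ≠ InfinitePlace.mk ι₁ → ((Matrix.diagonal dJ).map τ').PosDef)
        (h4 : 4 ≤ Module.finrank ℚ (F : Type))
        (r : Rep ↥(maximalRealSubfield (F : Type)) (imagUnitSq F))
        (ε : Eps ↥(maximalRealSubfield (F : Type)) (imagUnitSq F))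
        (_hadm : ∃ e : (F : Type), IsAdmissibleElement (F : Type) hμ.cmType.1 e ∧
          epsOf ↥(maximalRealSubfield (F : Type)) (imagUnitSq F) (F : Type) (2 * imagUnit (F : Type))⁻¹ (-e) = ε)
        (χ : Chi ↥(maximalRealSubfield (F : Type)) (F : Type) (IsCMField.complexConj (F : Type)))
        (𝔣 : ConeFrame (F : Type) Jstar (cmPlace (F : Type) ι₁)),
        ∃ ψ₀ : Representation.IntertwiningMap
            ((rhoVAtLine ↥(maximalRealSubfield (F : Type)) (F : Type) (IsCMField.complexConj (F : Type)) 2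
              (finProdFinEquiv : Fin 2 × Fin 1 ≃ Fin (2 * 1)) (Matrix.diagonal dJ)
              (complexConj_imagUnit F) (imagUnit_ne_zero F) (imagUnit_mul_self F) (realDiagonal_isSymm F dJ hdJ)
              (isUnit_det_realDiagonal F dJ hdJ hdJ0) (realDiagonal_map F dJ hdJ).symm
              (hsChiGS F finProdFinEquiv dJ hdJ hdJ0
                (toHeckeCharacter (F : Type) (galConj (IsCMField.complexConj (F : Type)) μ))
                (isUnitary_toHeckeCharacter (F : Type) (galConj (IsCMField.complexConj (F : Type)) μ))
                ((isOscillatorChar_toHeckeCharacter_iff (galConj (IsCMField.complexConj (F : Type)) μ)).mpr hμ.galConj))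
              (r.toFun ε) χ).comp
              (finAdelicCongr ↥(maximalRealSubfield (F : Type)) (F : Type) (IsCMField.complexConj (F : Type)) gstar ht hg).symm.toMonoidHom)
            (rightRep₂ ↥(maximalRealSubfield (F : Type)) (F : Type) (IsCMField.complexConj (F : Type)) Jstar),
          ∀ ψ : Representation.IntertwiningMap
            ((rhoVAtLine ↥(maximalRealSubfield (F : Type)) (F : Type) (IsCMField.complexConj (F : Type)) 2
              (finProdFinEquiv : Fin 2 × Fin 1 ≃ Fin (2 * 1)) (Matrix.diagonal dJ)
              (complexConj_imagUnit F) (imagUnit_ne_zero F) (imagUnit_mul_self F) (realDiagonal_isSymm F dJ hdJ)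
              (isUnit_det_realDiagonal F dJ hdJ hdJ0) (realDiagonal_map F dJ hdJ).symm
              (hsChiGS F finProdFinEquiv dJ hdJ hdJ0
                (toHeckeCharacter (F : Type) (galConj (IsCMField.complexConj (F : Type)) μ))
                (isUnitary_toHeckeCharacter (F : Type) (galConj (IsCMField.complexConj (F : Type)) μ))
                ((isOscillatorChar_toHeckeCharacter_iff (galConj (IsCMField.complexConj (F : Type)) μ)).mpr hμ.galConj))
              (r.toFun ε) χ).comp
              (finAdelicCongr ↥(maximalRealSubfield (F : Type)) (F : Type) (IsCMField.complexConj (F : Type)) gstar ht hg).symm.toMonoidHom)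
            (rightRep₂ ↥(maximalRealSubfield (F : Type)) (F : Type) (IsCMField.complexConj (F : Type)) Jstar),
          (∀ w, ψ w ∈ cohForms₂ ↥(maximalRealSubfield (F : Type)) (F : Type) (IsCMField.complexConj (F : Type)) Jstar
              (IsCMField.complexConj_ne_one (F : Type)) (UnitaryGroup.complexConj_smul_infinitePlace (F : Type))
              (cmPlace (F : Type) ι₁) 𝔣) → ∃ a : ℂ, ψ = a • ψ₀ := by
  intro F _ ι₁ μ hμ hw Jstar t ht hτt hτt' gstar dJ hdJ hdJ0 hg hsig h4 r ε hadm χ 𝔣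
  obtain ⟨hAB, hA, hB⟩ := CurveHodgeTypesDisjoint.hodgeTypes₂_disjoint_stable ↥(maximalRealSubfield (F : Type)) (F : Type)
    (IsCMField.complexConj (F : Type)) Jstar (IsCMField.complexConj_ne_one (F : Type)) (UnitaryGroup.complexConj_smul_infinitePlace (F : Type))
    (cmPlace (F : Type) ι₁) (CurveHodgeTypesDisjoint.isHermitian_map_of_formCongr (F : Type) ι₁ Jstar t ht hτt' gstar dJ hdJ hg _) 𝔣
  exact exists_line_of_split _ _ _ _ hAB hA hB
    (S1BettiSliceLinesNoE1.stub_L10_of_letters' hE1'h hDh hEh F ι₁ μ hμ hw Jstar t ht hτt hτt' gstar dJ hdJ hdJ0 hg hsig h4 r ε hadm χ 𝔣)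
    (S1BettiSliceLinesNoE1.stub_L01_of_letters'
      (Literature.NumberTheory.Automorphic.UnitaryCurveForms.curveCohFinComponentUnique_antihol_of_hol hE1'h)
      (Literature.NumberTheory.Automorphic.UnitaryCurveForms.antiholCotFormSpectralProjection₂_of_hol hDh)
      (Literature.NumberTheory.Automorphic.UnitaryCurveForms.cohIsotypicLine₂_antihol_of_hol hEh)
      F ι₁ μ hμ hw Jstar t ht hτt hτt' gstar dJ hdJ hdJ0 hg hsig h4 r ε hadm χ 𝔣)
    (S1BettiSliceExclusionSigned.stub_X_of_signed_letters hE3hol hE3antihol hDh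
      (Literature.NumberTheory.Automorphic.UnitaryCurveForms.antiholCotFormSpectralProjection₂_of_hol hDh)
      F ι₁ μ hμ hw Jstar t ht hτt hτt' gstar dJ hdJ hdJ0 hg hsig h4 r ε hadm χ 𝔣)

/-- **`stub_S1_betti_holds_signed'` — the parent's `stub_S1_betti : S1BettiShape` MODULO THE FIVE NAMED FACTS {E1′hol, E3hol, E3antihol, TPhol, E₂hol}** (NO E1)
(E2′ `curveThetaHodgeTypeRigid` NOT among them): ★ `F0AlbCmS1BettiHolds.s1BettiShape_of` at ★ `F0AlbCmS1BettiHolds.stub_S1_realisation` and HEAD‴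
`s1MultOneForms_of_signed_letters'`.  [Liu2021, Prop. D.4 (1)]: `dim Hom_{ℂ[G]}(ω⋆, H¹_B) ≤ 1`.  HC_CM is proved only modulo the 7 printed citations until rung 0 closes.
[cite: Liu2021, Prop. D.4 (1) and proof (p. 130–131); Rem. D.5 (p. 131); §D.2 (D.1)] [cite: Rogawski1990, §11.1 Prop. 11.1.1; Thm. 11.5.1]
[cite: BorelWallach2000, VII 3.2] -/
theorem stub_S1_betti_holds_signed' (hE1'h : Literature.NumberTheory.Rogawski1990.curveCohFinComponentUnique_hol)
    (hE3hol : Literature.NumberTheory.Rogawski1990.curveThetaHodgeTypeSigned_hol)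
    (hE3antihol : Literature.NumberTheory.Rogawski1990.curveThetaHodgeTypeSigned_antihol)
    (hDh : Literature.NumberTheory.Automorphic.UnitaryCurveForms.holCotFormSpectralProjection₂)
    (hEh : Literature.NumberTheory.Automorphic.UnitaryCurveForms.cohIsotypicLine₂_hol) : F0AlbCmS1BettiHolds.S1BettiShape :=
  F0AlbCmS1BettiHolds.s1BettiShape_of F0AlbCmS1BettiHolds.stub_S1_realisation
    (s1MultOneForms_of_signed_letters' hE1'h hE3hol hE3antihol hDh hEh)

end Summit.HodgeConjecture.HodgeConjecture.Cruxes.HLiu418.F0AlbCmS1BettiHoldsSignedNoE1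

end
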